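import Literature.NumberTheory.LFunctions.ConeWeylSums
import HarnessLib

/-!
# The lattice of logarithms of the totally positive units in the kernel of a residue character

Topic `Literature/NumberTheory/Sieve`, sub-namespace `UnitKernel`. First brick of the harmonic
analysis of the smooth character sums `Θ_{Ω'}(χ)` of `SmoothSmallModuli` on the unit torus
(T. Mitsui, *Generalized prime number theorem*, Jap. J. Math. 26 (1956), §3; E. Hecke, Math. Z. 6
(1920), §1): for a character `χ` of `(𝓞_K/𝔣)ˣ` the totally positive units `η` with `χ(η) = 1`
form a subgroup `U_𝔣 = U⁺ ∩ ker χ` of finite index `≤ #(𝓞_K/𝔣)ˣ` in `U⁺ = posUnits K`, and their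
logarithms a full lattice `L_𝔣 ≤ L⁺ = posUnitLattice K` in `logSpace K` — the period lattice of
the `U_𝔣`-periodised cube weights, whose dual indexes the Grössencharaktere `λ_m` with
`χ λ_m` trivial on `U_𝔣`.

* `unitChar χ : (𝓞 K)ˣ →* ℂ` — `u ↦ χ(u mod 𝔣)`;
* `kerPosUnits χ` — `U_𝔣 = U⁺ ∩ ker (unitChar χ)`;
* `pow_card_mem_kerPosUnits` — `u^{#(𝓞/𝔣)ˣ} ∈ U_𝔣` for `u ∈ U⁺`;
* `kerLattice χ` — `L_𝔣`, with `exists_of_mem_kerLattice`, `kerLattice_le`, discreteness and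
  **`IsZLattice ℝ (kerLattice χ)`** (full rank).

## References

* T. Mitsui, Jap. J. Math. 26 (1956), §3. [cite: Mitsui1956, §3]
* E. Hecke, *Eine neue Art von Zetafunktionen* II, Math. Z. 6 (1920), §1. [cite: HeckeMathZ1920, §1]

## Mathlib / tree search

Tree: `HeckeCone.posUnits`, `posUnitLattice` (`exists_of_mem_posUnitLattice`,
`instIsZLatticePosUnitLattice`), `logEmbedding`, `AbelianDensity.toMulHom`. Nothing on kernels of
residue characters restricted to units.
-/

noncomputable section

open NumberField NumberField.InfinitePlace NumberField.Units NumberField.Units.dirichletUnitTheorem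
  Literature.NumberTheory.LFunctions Literature.NumberTheory.LFunctions.HeckeCone
  Literature.NumberTheory.LFunctions.AbelianDensity
open scoped Classical

namespace Literature.NumberTheory.Sieve.UnitKernel

variable {K : Type*} [Field K] [NumberField K]
variable {𝔣 : Ideal (𝓞 K)}

/-- `u ↦ χ(u mod 𝔣)` on the units of `𝓞_K`. [folklore] -/
def unitChar (χ : AddChar (Additive ((𝓞 K ⧸ 𝔣)ˣ)) ℂ) : (𝓞 K)ˣ →* ℂ :=
  (toMulHom χ).comp (Units.map (Ideal.Quotient.mk 𝔣).toMonoidHom)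

omit [NumberField K] in
/-- Unfolding `unitChar`. [folklore] -/
theorem unitChar_apply (χ : AddChar (Additive ((𝓞 K ⧸ 𝔣)ˣ)) ℂ) (u : (𝓞 K)ˣ) :
    unitChar χ u = toMulHom χ (Units.map (Ideal.Quotient.mk 𝔣).toMonoidHom u) := rfl

/-- **`U_𝔣 = U⁺ ∩ ker χ`**: the totally positive units on which `χ` is trivial. [cite: Mitsui1956, §3] -/
def kerPosUnits (χ : AddChar (Additive ((𝓞 K ⧸ 𝔣)ˣ)) ℂ) : Subgroup (𝓞 K)ˣ :=
  posUnits K ⊓ (unitChar χ).ker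

/-- Membership in `U_𝔣`. [folklore] -/
theorem mem_kerPosUnits {χ : AddChar (Additive ((𝓞 K ⧸ 𝔣)ˣ)) ℂ} {u : (𝓞 K)ˣ} :
    u ∈ kerPosUnits χ ↔ u ∈ posUnits K ∧ unitChar χ u = 1 := by
  rw [kerPosUnits, Subgroup.mem_inf, MonoidHom.mem_ker]

/-- `U_𝔣 ≤ U⁺`. [folklore] -/
theorem kerPosUnits_le (χ : AddChar (Additive ((𝓞 K ⧸ 𝔣)ˣ)) ℂ) : kerPosUnits χ ≤ posUnits K := inf_le_left

/-- **`u^{#(𝓞/𝔣)ˣ} ∈ U_𝔣`** for every totally positive unit `u`: `U_𝔣` has finite index in `U⁺`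
(for `𝔣 = 0` the exponent is `Nat.card = 0` and the statement is trivial). [cite: Mitsui1956, §3] -/
theorem pow_card_mem_kerPosUnits (χ : AddChar (Additive ((𝓞 K ⧸ 𝔣)ˣ)) ℂ) {u : (𝓞 K)ˣ}
    (hu : u ∈ posUnits K) : u ^ Nat.card ((𝓞 K ⧸ 𝔣)ˣ) ∈ kerPosUnits χ := by
  refine mem_kerPosUnits.2 ⟨(posUnits K).pow_mem hu _, ?_⟩
  rw [map_pow, unitChar_apply, ← map_pow, pow_card_eq_one', map_one]

/-! ## The lattice `L_𝔣` -/

/-- **`L_𝔣`**: the logarithms of the units of `U_𝔣`, a full lattice in `logSpace K`.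
[cite: HeckeMathZ1920, §1] -/
def kerLattice (χ : AddChar (Additive ((𝓞 K ⧸ 𝔣)ˣ)) ℂ) : Submodule ℤ (logSpace K) :=
  Submodule.span ℤ (Set.range fun u : kerPosUnits χ => logEmbedding K (Additive.ofMul (u : (𝓞 K)ˣ)))

/-- Logarithms of units of `U_𝔣` lie in `L_𝔣`. [folklore] -/
theorem logEmbedding_mem_kerLattice {χ : AddChar (Additive ((𝓞 K ⧸ 𝔣)ˣ)) ℂ} {u : (𝓞 K)ˣ} (hu : u ∈ kerPosUnits χ) :
    logEmbedding K (Additive.ofMul u) ∈ kerLattice χ :=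
  Submodule.subset_span ⟨⟨u, hu⟩, rfl⟩

/-- Every element of `L_𝔣` is the logarithm of a unit of `U_𝔣`. [folklore] -/
theorem exists_of_mem_kerLattice {χ : AddChar (Additive ((𝓞 K ⧸ 𝔣)ˣ)) ℂ} {x : logSpace K} (hx : x ∈ kerLattice χ) :
    ∃ u : (𝓞 K)ˣ, u ∈ kerPosUnits χ ∧ logEmbedding K (Additive.ofMul u) = x := by
  induction hx using Submodule.span_induction with
  | mem x hx =>
    obtain ⟨u, rfl⟩ := hx
    exact ⟨u, u.2, rfl⟩
  | zero => exact ⟨1, (kerPosUnits χ).one_mem, by simp⟩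
  | add x y _ _ hx hy =>
    obtain ⟨u, hu, rfl⟩ := hx
    obtain ⟨v, hv, rfl⟩ := hy
    exact ⟨u * v, (kerPosUnits χ).mul_mem hu hv, by rw [ofMul_mul, map_add]⟩
  | smul n x _ hx =>
    obtain ⟨u, hu, rfl⟩ := hx
    exact ⟨u ^ n, (kerPosUnits χ).zpow_mem hu n, by rw [ofMul_zpow, map_zsmul]⟩

/-- `L_𝔣 ≤ L⁺`. [folklore] -/
theorem kerLattice_le (χ : AddChar (Additive ((𝓞 K ⧸ 𝔣)ˣ)) ℂ) : kerLattice χ ≤ posUnitLattice K := by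
  refine Submodule.span_le.2 ?_
  rintro _ ⟨u, rfl⟩
  exact logEmbedding_mem_posUnitLattice (kerPosUnits_le χ u.2)

/-- `L_𝔣` is discrete. [folklore] -/
instance instDiscreteTopologyKerLattice (χ : AddChar (Additive ((𝓞 K ⧸ 𝔣)ˣ)) ℂ) : DiscreteTopology (kerLattice χ) :=
  DiscreteTopology.of_subset (inferInstance : DiscreteTopology (posUnitLattice K)) (kerLattice_le χ)

/-- **`L_𝔣` is a full lattice** (`𝔣 ≠ 0`): it contains `#(𝓞/𝔣)ˣ · L⁺`. [cite: HeckeMathZ1920, §1] -/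
theorem isZLattice_kerLattice (h𝔣 : 𝔣 ≠ ⊥) (χ : AddChar (Additive ((𝓞 K ⧸ 𝔣)ˣ)) ℂ) : IsZLattice ℝ (kerLattice χ) := by
  haveI : Finite (𝓞 K ⧸ 𝔣) := Ideal.finiteQuotientOfFreeOfNeBot 𝔣 h𝔣
  refine ⟨?_⟩
  have htop := (inferInstance : IsZLattice ℝ (posUnitLattice K)).span_top
  rw [eq_top_iff, ← htop]
  refine Submodule.span_le.2 fun x hx => ?_
  obtain ⟨u, hu, rfl⟩ := exists_of_mem_posUnitLattice hx
  set N : ℕ := Nat.card ((𝓞 K ⧸ 𝔣)ˣ) with hN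
  have hNpos : 0 < N := Nat.card_pos
  have hmem : (N : ℝ) • logEmbedding K (Additive.ofMul u) ∈ (kerLattice χ : Set (logSpace K)) := by
    have : (N : ℝ) • logEmbedding K (Additive.ofMul u) = logEmbedding K (Additive.ofMul (u ^ N)) := by
      rw [ofMul_pow, map_nsmul, Nat.cast_smul_eq_nsmul]
    rw [this]
    exact logEmbedding_mem_kerLattice (pow_card_mem_kerPosUnits χ hu)
  have : logEmbedding K (Additive.ofMul u) = (N : ℝ)⁻¹ • ((N : ℝ) • logEmbedding K (Additive.ofMul u)) := by
    rw [smul_smul, inv_mul_cancel₀ (by exact_mod_cast hNpos.ne'), one_smul]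
  rw [this]
  exact Submodule.smul_mem _ _ (Submodule.subset_span hmem)

/-- Every positive unit power-congruent: `[U⁺ : U_𝔣]` is finite — in the form used downstream,
for every `u ∈ U⁺` some positive power lies in `U_𝔣`. [folklore] -/
theorem exists_pow_mem_kerPosUnits (h𝔣 : 𝔣 ≠ ⊥) (χ : AddChar (Additive ((𝓞 K ⧸ 𝔣)ˣ)) ℂ) {u : (𝓞 K)ˣ}
    (hu : u ∈ posUnits K) : ∃ n : ℕ, 0 < n ∧ u ^ n ∈ kerPosUnits χ := by
  haveI : Finite (𝓞 K ⧸ 𝔣) := Ideal.finiteQuotientOfFreeOfNeBot 𝔣 h𝔣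
  exact ⟨Nat.card ((𝓞 K ⧸ 𝔣)ˣ), Nat.card_pos, pow_card_mem_kerPosUnits χ hu⟩

/-- On `U_𝔣` the character `χ` is `1`, so `χ(ηω) = χ(ω)` for `η ∈ U_𝔣`. [folklore] -/
theorem toMulHom_units_map_mul {χ : AddChar (Additive ((𝓞 K ⧸ 𝔣)ˣ)) ℂ} {η : (𝓞 K)ˣ} (hη : η ∈ kerPosUnits χ)
    (γ : (𝓞 K ⧸ 𝔣)ˣ) :
    toMulHom χ (Units.map (Ideal.Quotient.mk 𝔣).toMonoidHom η * γ) = toMulHom χ γ := by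
  rw [map_mul]
  have h : toMulHom χ (Units.map (Ideal.Quotient.mk 𝔣).toMonoidHom η) = 1 := (mem_kerPosUnits.1 hη).2
  rw [h, one_mul]

end Literature.NumberTheory.Sieve.UnitKernel
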